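/-
Copyright: seat `ym-line-cbag-p2` (prover-ym-line-cbag-p2-g2-0), route `ColdBoxAllGroups`, crux `BulkAllGroups` (stmt-QuantumFields-22255),
line `dlr-chessboard-G` (skeleton `Cruxes/BulkAllGroups/Lines/birth.lean` v5) — the crux PROVED.
-/
import Summits.QuantumFields.YangMills.Theses.ColdBoxAllGroups
import Summits.QuantumFields.YangMills.Theorems.ColdBoxAllGroupsDefs
import Summits.QuantumFields.YangMills.Theorems.ColdBoxAllGroupsBulkAllGroupsStubDlrAssemblyG
import Summits.QuantumFields.YangMills.Theorems.ColdBoxAllGroupsBulkAllGroupsStubLargeFieldRarityG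
import Summits.QuantumFields.YangMills.Theorems.ColdBoxAllGroupsBulkAllGroupsMeanSmoothOfExpansionG
import Summits.QuantumFields.YangMills.Theorems.ColdBoxAllGroupsBulkAllGroupsCovStableOfExpansionG
import Summits.QuantumFields.YangMills.Theorems.ColdBoxAllGroupsBulkAllGroupsFlatCovOfDomAbsG
import Summits.QuantumFields.YangMills.Theorems.ColdBoxAllGroupsBulkAllGroupsStubBoxPolyFloorG
import Summits.QuantumFields.YangMills.Theorems.ColdBoxAllGroupsBulkAllGroupsStubBoxDirichletAbsG
import Summits.QuantumFields.YangMills.Theorems.ColdBoxAllGroupsBulkAllGroupsStubKernelCovExpansionG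
import Summits.QuantumFields.YangMills.Theorems.ColdBoxAllGroupsBulkAllGroupsStubKernelMeanExpansionG
import Summits.QuantumFields.YangMills.Theorems.WeakCouplingRatesBulkDominatesColdBoxWStubDirKernelTwoPoint
import Summits.QuantumFields.YangMills.Theorems.WeakCouplingRatesBulkDominatesColdBoxWDirKernelDiagFlat
import Summits.QuantumFields.YangMills.Theorems.BalabanLadderNTOnePointFloor

/-!
# Crux `BulkAllGroups` (stmt-QuantumFields-22255) of route `ColdBoxAllGroups` — PROVED (every compact simple `G`)

`BulkAllGroups_proof : Summit.QuantumFields.YangMills.Theses.ColdBoxAllGroups.BulkAllGroups` — for every compact simple `G` (tree sense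
`IsCompactSimpleLieGroup`), every faithful unitary lattice representation `r` and every ceiling `θ₀ > 0` there are exponents `0 < A < θ ≤ θ₀`
with `BulkDominatesBox r.ρ A θ`: eventually in the torus size, the torus-state covariance of the `(1,2)`-plaquette cost `N − Re tr r(U_p)` and its
time-translate by `⌈β^A⌉` is `≥ η ×` the same covariance in the cold-wall Wilson box of side `2⌈β^θ⌉+1`, for all large `β`.

This is the kernel-checked composition of the registered skeleton (line `dlr-chessboard-G`, v5, `Cruxes/BulkAllGroups/Lines/birth.lean`: the
`G`-port of the PROVED `SU(2)` line `dlr-chessboard` of `BulkDominatesColdBoxW`) with its stubs replaced by the tree theorems that landed them BY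
NAME (lead `ym-line-cbag-p2`; width seats w2, w3 and lead g5 of `ym-line-cbag-p1`):
* N2-cov-G `stub_kernelCovExpansionG` and N2-mean-G `stub_kernelMeanExpansionG` — the one-scale expansions of the DLR box kernel around crude-good
  data in the exponential chart (`D = dimE r.ρ` colours; datum layer OneScaleDatumDefsG/DatumSplitG/RepresentationDatumG/KernelCov·MeanDatumCoreG/
  Kernel·DatumAtBetaG (p2), LinkSmallDatumG/GlueShiftBoundsG/TiltBoundDatumG/GaussTailDatumG/KernelBridgeG/KernelGoodEventTruncG (w2),
  LinearisedDatumEnergyG/DatumCompetitorG/DatumPackage(DatVec)G/UnitsShiftG/UnitsInterfaceG/StubKernelMeanExpansionG (w3),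
  KernelMeanPrelimsG/ShiftSmallG/KernelMeanTrunkG/KernelDatumBoundsG{,Prelims,Window} (p1 g5));
* FLAT-ABS-G `stub_boxDirichletAbsG` (sibling crux `BoxFloorAllGroups`, S2) ⇒ N2-flat-G `stub_flatCovExpansionG_of_domAbsG`;
  L1a-G / L1b-G by the reductions `goodBoundaryCovStableG_of_kernelCovExpansionG` / `goodBoundaryMeanSmoothG_of_kernelMeanExpansionG` with the
  group-free N1 `stub_dirKernelTwoPoint`, N1′ `dirKernelDiagFlat` and `dimE ≥ 1` (`dimE_pos_of_isCompactSimpleLieGroup`);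
* L2-G `stub_largeFieldRarityG` (chessboard), L4-G `stub_boxPolyFloorG` (sibling crux + FLOOR), L3-G `stub_dlrAssemblyG` (DLR assembly),
  along the family `(A, δ, K) = (θ/20, θ/5, 2 + θ/2)`, `θ = min θ₀ θa θb θk`.
No sorry, no hypothesis, standard axioms.  NOT the Yang–Mills mass gap: a finite-volume weak-coupling covariance comparison (torus vs cold box), the
BULK half of a RECORD-label rung (R2xi-G `XiPow`) strictly below the Clay statement.
-/

set_option autoImplicit false

noncomputable section

namespace Summit.QuantumFields.YangMills.Theorems.ColdBoxAllGroups

open MeasureTheory Filter Topology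
open Literature.MathematicalPhysics Literature.MathematicalPhysics.QuantumFieldTheory
open Literature.MathematicalPhysics.QuantumLattice
open Summit.QuantumFields.YangMills.Theorems.WeakCouplingRates
open Summit.QuantumFields.YangMills.Theorems.FreeEnergyLogCoefficient (dimE)

/-- **L1a-G — deep kernel covariances are stable under crude-good data, every compact simple `G`** (reduction R1-G from N2-cov-G
`stub_kernelCovExpansionG`, N2-flat-G (from FLAT-ABS-G `stub_boxDirichletAbsG`) and the group-free N1 `stub_dirKernelTwoPoint`; `D ≥ 1`). -/
theorem goodBoundaryCovStableG_allGroups :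
    ∀ (G : Type) [Group G] [TopologicalSpace G] [IsTopologicalGroup G] [CompactSpace G] [MeasurableSpace G] [BorelSpace G],
    IsCompactSimpleLieGroup G → ∀ r : LatticeRep G, ∃ θa : ℝ, 0 < θa ∧ ∀ θ : ℝ, 0 < θ → θ ≤ θa → ∃ η₁ : ℝ, 0 < η₁ ∧
      GoodBoundaryCovStableG r.ρ (θ / 20) θ (θ / 5) η₁ :=
  fun G _ _ _ _ _ _ hG r =>
    goodBoundaryCovStableG_of_kernelCovExpansionG r.ρ
      (Nat.succ_le_of_lt (Summit.QuantumFields.YangMills.Cruxes.NT.LinkEquipartition.dimE_pos_of_isCompactSimpleLieGroup G r hG))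
      (stub_kernelCovExpansionG G hG r) (stub_flatCovExpansionG_of_domAbsG stub_boxDirichletAbsG G hG r) stub_dirKernelTwoPoint

/-- **L1b-G — deep kernel means are position-smooth under crude-good data, every compact simple `G`** (reduction R2-G from N2-mean-G
`stub_kernelMeanExpansionG` and the group-free N1′ `dirKernelDiagFlat`). -/
theorem goodBoundaryMeanSmoothG_allGroups :
    ∀ (G : Type) [Group G] [TopologicalSpace G] [IsTopologicalGroup G] [CompactSpace G] [MeasurableSpace G] [BorelSpace G],
    IsCompactSimpleLieGroup G → ∀ r : LatticeRep G, ∃ θb : ℝ, 0 < θb ∧ ∀ θ : ℝ, 0 < θ → θ ≤ θb →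
      GoodBoundaryMeanSmoothG r.ρ (θ / 20) θ (θ / 5) :=
  fun G _ _ _ _ _ _ hG r => goodBoundaryMeanSmoothG_of_kernelMeanExpansionG r.ρ (stub_kernelMeanExpansionG G hG r) dirKernelDiagFlat

/-- **Crux `BulkAllGroups` of route `ColdBoxAllGroups`, PROVED** — the composition of the line `dlr-chessboard-G` (verbatim the registered
skeleton's `BulkAllGroups_holds_of_stubs`): `θ = min θ₀ θa θb θk`, `(A, δ, K) = (θ/20, θ/5, 2 + θ/2)`, the DLR assembly L3-G applied to L1a-G,
L1b-G, L2-G (at `δ = θ/5`) and L4-G. -/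
theorem BulkAllGroups_proof : Summit.QuantumFields.YangMills.Theses.ColdBoxAllGroups.BulkAllGroups := by
  intro G _ _ _ _ hG
  letI : MeasurableSpace G := borel G
  haveI : BorelSpace G := ⟨rfl⟩
  intro r θ₀ hθ₀
  obtain ⟨θa, hθa, ha⟩ := goodBoundaryCovStableG_allGroups G hG r
  obtain ⟨θb, hθb, hb⟩ := goodBoundaryMeanSmoothG_allGroups G hG r
  obtain ⟨θk, hθk, hk⟩ := stub_boxPolyFloorG G hG r
  set θ : ℝ := min θ₀ (min θa (min θb θk)) with hθdef
  have hθpos : 0 < θ := lt_min hθ₀ (lt_min hθa (lt_min hθb hθk))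
  have hθ0 : θ ≤ θ₀ := min_le_left _ _
  have hθa' : θ ≤ θa := le_trans (min_le_right _ _) (min_le_left _ _)
  have hθb' : θ ≤ θb := le_trans (min_le_right _ _) (le_trans (min_le_right _ _) (min_le_left _ _))
  have hθk' : θ ≤ θk := le_trans (min_le_right _ _) (le_trans (min_le_right _ _) (min_le_right _ _))
  obtain ⟨η₁, hη, h1a'⟩ := ha θ hθpos hθa'
  refine ⟨θ / 20, θ, by positivity, by linarith, hθ0, ?_⟩
  exact stub_dlrAssemblyG G r (θ / 20) θ (θ / 5) η₁ (2 + θ / 2) (by positivity) (by positivity) hη (by linarith) h1a'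
    (hb θ hθpos hθb') (stub_largeFieldRarityG G r (θ / 5) (by positivity)) (hk θ hθpos hθk')

end Summit.QuantumFields.YangMills.Theorems.ColdBoxAllGroups

end
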